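import Mathlib
import HarnessLib
import Summits.HubbardSuperconductivity.HubbardSuperconductivity.Theorems.KLProgrammePerturbedFermiCurveExplicit
import Summits.HubbardSuperconductivity.HubbardSuperconductivity.Theorems.KLProgrammePerturbedFermiCurveCompChainStruct

/-!
# Route `KLProgramme` — the Fermi curve of an admissible frame, ORDER BY ORDER with the frame's order-3/4 allowances kept SYMBOLIC:
# `‖γ′‖ ≤ D1`, `‖γ″‖ ≤ D2` (absolute constants), `‖γ‴‖ ≤ D3(A₃)`, `‖γ⁗‖ ≤ D4(A₃, A₄)` AFFINE in `A₃ = ‖D³K‖`, `A₄ = ‖D⁴K‖`; and the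
# structured sizes of any smooth symbol read along it

Cell `gate-hubbard-kl`, seat hubbard-kl-k3c3-p3 (g3; row «implicit-function / monotonicity route»).  For the ENGINE child's two-leg stubs
(stmt-HubbardSuperconductivity-19855), clause (E3a-MS) `TwoLegSizesMS` (gen 5: `…MSFn`): the scale-`n` piece is the increment `δν_n = ΔD_n ∘ γ_K`
read along the frame's curve, and its order-3/4 sizes must keep (i) the scale-`n` grading of the increment (`m_k(Δσ_n) ≍ U²4^{(k−2)n}`) and
(ii) the LINEAR dependence on the deeper slots' frame allowances (HOME/prover-p1b/g6/TWO-LEG-CLOSERS.md §2 (M5); p1b: «the graded composite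
of k3c3-p3 (affine in E₃, E₄) is the analytic input»).  The graded packaging `D = C₀·2^{N+1}` of `…Explicit` (p485512) loses (i); this module
keeps every order separate:

* §1 named constants: `klCurveK1 = R1 + π√2`, `klCurveK2 = R2 + 2R1 + π√2`; the radius-tower tops `klCurveT3 A₃`, `klCurveT4 A₃ A₄` (the
  worst-case right-hand sides of `abs_deriv_three/four_frameRadius_le` at `A ≤ 1/20`, `d = cDtmin/2`; `klCurveR3 R = klCurveT3 (Gfr₃)` by `rfl`)
  with their AFFINE forms `klCurveT3 A₃ = klCurveT3 0 + klCurveB3·A₃`, `klCurveT4 A₃ A₄ = klCurveT4 0 0 + klCurveB4·A₃ + klCurveG4·A₄`;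
  the curve sizes `klCurveD1`, `klCurveD2`, `klCurveD3 A₃`, `klCurveD4 A₃ A₄` (`= 2·Σ_k C(i,k)·(tower top)_k`).
* §2 `norm_iteratedFDeriv_fermiPointLp_le_perOrder` (any frame with the lineage's `C²` data): `|u^{(k)}(θ)| ≤ T k` (`k ≤ 4`) ⟹
  `‖Dⁱγ(θ)‖ ≤ 2·Σ_{k≤i} C(i,k)·T k` (Leibniz for `u • dir`, `‖Dᵐ dir‖ ≤ 1`, `‖toLp‖ ≤ 2`).
* §3 `frameRadius_tower_explicit` / `fermiPointLp_sizes_explicit` (regime, thresholds `klCurveC3 R`, `klCurveU0 R` of `…Explicit`): for an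
  admissible frame and ANY `A₃ ≥ ‖D³ frameShift K‖`, `A₄ ≥ ‖D⁴ frameShift K‖`: `|u| ≤ π√2`, `|u′| ≤ R1`, `|u″| ≤ R2`, `|u‴| ≤ T3(A₃)`,
  `|u⁗| ≤ T4(A₃,A₄)` and `‖Dⁱγ_K‖ ≤ klCurveD_i (…)`.
* §4 `abs_iteratedDeriv_comp_fermiPointLp_le_struct`: for any `C⁴` symbol `F` on `Momentum` with `‖DᵏF(γ_K θ)‖ ≤ m k` the four Bell-polynomial
  bounds of `…CompChainStruct` (p485980) with these `D_i` — the scale-`n` increment's angular sizes with the multi-slot structure visible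
  (`m 1·klCurveD4 A₃ A₄` is affine in `A₄ = Σ_m Gfr₄·U²·16^m`).

Definitions of real constants + proofs; nothing is asserted about the Hubbard model.  References: BGM 2006 §2.4 (2.40), (2.42)
[cite: BenfattoGiulianiMastropietro2006].
-/

noncomputable section

namespace Summit.HubbardSuperconductivity.HubbardSuperconductivity.Theorems.PerturbedFermiCurve

set_option linter.dupNamespace false -- summit = problem name (single-conjunct summit), D-0017

open Real Set Finset
open Literature.MathematicalPhysics.QuantumLattice Literature.MathematicalPhysics.QuantumLattice.BandSectorCounting
open Literature.Probability.LatticeModels Literature.MathematicalPhysics.QuantumLattice.FermiRG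
open Summit.HubbardSuperconductivity.HubbardSuperconductivity.Theorems.DispersionFlow
open Summit.HubbardSuperconductivity.HubbardSuperconductivity.Theorems.KLRegimeSplit

/-! ## §1 Named constants and their affine structure -/

/-- `K1 = R1 + π√2` (bound of `‖k₁‖`-type combinations `|u′| + |u|`). -/
def klCurveK1 : ℝ := klCurveR1 + π * Real.sqrt 2

/-- `K2 = R2 + 2R1 + π√2`. -/
def klCurveK2 : ℝ := klCurveR2 + 2 * klCurveR1 + π * Real.sqrt 2

/-- **Order-3 radius-tower top** `T3(A₃) = ((4+8A₃)K1³ + 3(4+1/5)K1K2 + (4+1/10)(3R2+3R1+π√2))/d`, AFFINE in the order-3 size `A₃`. -/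
def klCurveT3 (A₃ : ℝ) : ℝ :=
  ((4 + 8 * A₃) * (klCurveR1 + π * Real.sqrt 2) ^ 3 +
      3 * (4 + 1 / 5) * (klCurveR1 + π * Real.sqrt 2) * (klCurveR2 + 2 * klCurveR1 + π * Real.sqrt 2) +
      (4 + 1 / 10) * (3 * klCurveR2 + 3 * klCurveR1 + π * Real.sqrt 2)) / klCurveD

/-- **Order-4 radius-tower top** `T4(A₃, A₄)`, AFFINE in `A₃` and `A₄`. -/
def klCurveT4 (A₃ A₄ : ℝ) : ℝ :=
  ((4 + 16 * A₄) * (klCurveR1 + π * Real.sqrt 2) ^ 4 +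
      6 * (4 + 8 * A₃) * (klCurveR1 + π * Real.sqrt 2) ^ 2 * (klCurveR2 + 2 * klCurveR1 + π * Real.sqrt 2) +
      3 * (4 + 1 / 5) * (klCurveR2 + 2 * klCurveR1 + π * Real.sqrt 2) ^ 2 +
      4 * (4 + 1 / 5) * (klCurveR1 + π * Real.sqrt 2) * (klCurveT3 A₃ + 3 * klCurveR2 + 3 * klCurveR1 + π * Real.sqrt 2) +
      (4 + 1 / 10) * (4 * klCurveT3 A₃ + 6 * klCurveR2 + 4 * klCurveR1 + π * Real.sqrt 2)) / klCurveD

/-- Slope of `T3` in `A₃`: `8·K1³/d`. -/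
def klCurveB3 : ℝ := 8 * klCurveK1 ^ 3 / klCurveD

/-- Slope of `T4` in `A₃`: `(48·K1²·K2 + (4(4+1/5)K1 + 4(4+1/10))·B3)/d`. -/
def klCurveB4 : ℝ := (48 * klCurveK1 ^ 2 * klCurveK2 + (4 * (4 + 1 / 5) * klCurveK1 + 4 * (4 + 1 / 10)) * klCurveB3) / klCurveD

/-- Slope of `T4` in `A₄`: `16·K1⁴/d`. -/
def klCurveG4 : ℝ := 16 * klCurveK1 ^ 4 / klCurveD

/-- Curve size, order 1: `D1 = 2(π√2 + R1)`. -/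
def klCurveD1 : ℝ := 2 * (π * Real.sqrt 2 + klCurveR1)

/-- Curve size, order 2: `D2 = 2(π√2 + 2R1 + R2)`. -/
def klCurveD2 : ℝ := 2 * (π * Real.sqrt 2 + 2 * klCurveR1 + klCurveR2)

/-- Curve size, order 3: `D3(A₃) = 2(π√2 + 3R1 + 3R2 + T3(A₃))` — affine in `A₃`. -/
def klCurveD3 (A₃ : ℝ) : ℝ := 2 * (π * Real.sqrt 2 + 3 * klCurveR1 + 3 * klCurveR2 + klCurveT3 A₃)

/-- Curve size, order 4: `D4(A₃,A₄) = 2(π√2 + 4R1 + 6R2 + 4T3(A₃) + T4(A₃,A₄))` — affine in `A₃, A₄`. -/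
def klCurveD4 (A₃ A₄ : ℝ) : ℝ := 2 * (π * Real.sqrt 2 + 4 * klCurveR1 + 6 * klCurveR2 + 4 * klCurveT3 A₃ + klCurveT4 A₃ A₄)

/-- `klCurveR3 R = T3(Gfr₃)`. -/
theorem klCurveR3_eq_T3 (R : RenConsts) : klCurveR3 R = klCurveT3 (R.Gfr 3) := rfl

/-- `klCurveR4 R = T4(Gfr₃, Gfr₄)`. -/
theorem klCurveR4_eq_T4 (R : RenConsts) : klCurveR4 R = klCurveT4 (R.Gfr 3) (R.Gfr 4) := rfl

/-- **`T3` is affine**: `T3(A₃) = T3(0) + B3·A₃`. -/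
theorem klCurveT3_affine (A₃ : ℝ) : klCurveT3 A₃ = klCurveT3 0 + klCurveB3 * A₃ := by
  unfold klCurveT3 klCurveB3 klCurveK1
  have hd : klCurveD ≠ 0 := klCurveD_pos.ne'
  field_simp
  ring

/-- **`T4` is affine**: `T4(A₃,A₄) = T4(0,0) + B4·A₃ + G4·A₄`. -/
theorem klCurveT4_affine (A₃ A₄ : ℝ) : klCurveT4 A₃ A₄ = klCurveT4 0 0 + klCurveB4 * A₃ + klCurveG4 * A₄ := by
  have h3 := klCurveT3_affine A₃
  unfold klCurveT4 klCurveB4 klCurveG4 klCurveK2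
  rw [h3]
  unfold klCurveB3 klCurveK1
  have hd : klCurveD ≠ 0 := klCurveD_pos.ne'
  field_simp
  ring

/-- **`D3` is affine**: `D3(A₃) = D3(0) + 2·B3·A₃`. -/
theorem klCurveD3_affine (A₃ : ℝ) : klCurveD3 A₃ = klCurveD3 0 + 2 * klCurveB3 * A₃ := by
  unfold klCurveD3; rw [klCurveT3_affine A₃]; ring

/-- **`D4` is affine**: `D4(A₃,A₄) = D4(0,0) + (8·B3 + 2·B4)·A₃ + 2·G4·A₄`. -/
theorem klCurveD4_affine (A₃ A₄ : ℝ) :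
    klCurveD4 A₃ A₄ = klCurveD4 0 0 + (8 * klCurveB3 + 2 * klCurveB4) * A₃ + 2 * klCurveG4 * A₄ := by
  unfold klCurveD4; rw [klCurveT3_affine A₃, klCurveT4_affine A₃ A₄]; ring

/-- `0 ≤ T3(A₃)` for `A₃ ≥ 0`. -/
theorem klCurveT3_nonneg {A₃ : ℝ} (hA₃ : 0 ≤ A₃) : 0 ≤ klCurveT3 A₃ := by
  have := klCurveD_pos; have := klCurveR1_nonneg; have := klCurveR2_nonneg; unfold klCurveT3; positivity

/-! ## §2 Per-order curve sizes from the radius tower -/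

section Curve

variable {a b : ℝ} (B : BandBounds a b) {K : TrigPolyC4v} {A : ℝ}
  (hA : ∀ p : Momentum, ∀ j ≤ 2, ‖iteratedFDeriv ℝ j (frameShift K) p‖ ≤ A) (hADt : 2 * A < B.Dtmin)
  {μ : ℝ} (hlo : a ≤ μ - A) (hhi : μ + A ≤ b)
include B hA hADt hlo hhi

/-- **Per-order curve sizes from per-order radius bounds**: if `|u_K^{(k)}(θ)| ≤ T k` for `k ≤ 4` (`k = 0` included), then for `1 ≤ i ≤ 4`
`‖Dⁱ(θ ↦ toLp 2 (k_F^K θ))(θ)‖ ≤ 2·Σ_{k ≤ i} C(i,k)·T k` (Leibniz for `u • dir`, `‖Dᵐ dir‖ ≤ 1`, `‖toLp‖ ≤ 2`). -/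
theorem norm_iteratedFDeriv_fermiPointLp_le_perOrder {θ : ℝ} {T : ℕ → ℝ}
    (hT : ∀ k ≤ 4, |iteratedDeriv k (perturbedFermiRadius (fun p : Fin 2 → ℝ => -K.eval p) μ) θ| ≤ T k)
    {i : ℕ} (hi4 : i ≤ 4) :
    ‖iteratedFDeriv ℝ i (fun θ : ℝ => (WithLp.toLp 2 (klFermiPoint μ K θ) : Momentum)) θ‖ ≤
      2 * ∑ k ∈ range (i + 1), (i.choose k : ℝ) * T k := by
  set u := perturbedFermiRadius (fun p : Fin 2 → ℝ => -K.eval p) μ with hudef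
  set Tl := ((EuclideanSpace.equiv (Fin 2) ℝ).symm : (Fin 2 → ℝ) →L[ℝ] Momentum) with hTl
  have hγ : (fun θ : ℝ => (WithLp.toLp 2 (klFermiPoint μ K θ) : Momentum)) = Tl ∘ fun θ => u θ • dir θ := by
    funext ϑ; simp [hTl, klFermiPoint, hudef]
  have hu4 : ContDiff ℝ 4 u := contDiff_klFermiRadius B hA hADt hlo hhi (m := 4)
  have hf4 : ContDiff ℝ 4 (fun θ => u θ • dir θ) := hu4.smul contDiff_dir
  rw [hγ, Tl.iteratedFDeriv_comp_left hf4.contDiffAt (by exact_mod_cast hi4)]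
  refine (Tl.norm_compContinuousMultilinearMap_le _).trans ?_
  have hu_k : ∀ k ≤ 4, ‖iteratedFDeriv ℝ k u θ‖ ≤ T k := by
    intro k hk4
    rw [norm_iteratedFDeriv_eq_norm_iteratedDeriv, Real.norm_eq_abs]
    exact hT k hk4
  have hL := norm_iteratedFDeriv_smul_le (N := ((4 : ℕ) : WithTop ℕ∞)) hu4 contDiff_dir θ (n := i) (by exact_mod_cast hi4)
  have hterm : ∀ k ∈ range (i + 1), (i.choose k : ℝ) * ‖iteratedFDeriv ℝ k u θ‖ * ‖iteratedFDeriv ℝ (i - k) dir θ‖ ≤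
      (i.choose k : ℝ) * T k := by
    intro k hk
    have hki : k ≤ i := Nat.lt_succ_iff.1 (mem_range.1 hk)
    have hT0 : 0 ≤ T k := (abs_nonneg _).trans (hT k (hki.trans hi4))
    calc (i.choose k : ℝ) * ‖iteratedFDeriv ℝ k u θ‖ * ‖iteratedFDeriv ℝ (i - k) dir θ‖
        ≤ (i.choose k : ℝ) * T k * 1 :=
          mul_le_mul (mul_le_mul_of_nonneg_left (hu_k k (hki.trans hi4)) (by positivity)) (norm_iteratedFDeriv_dir_le _ _)
            (norm_nonneg _) (by positivity)
      _ = (i.choose k : ℝ) * T k := mul_one _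
  have hT2 : ‖Tl‖ ≤ 2 := norm_toLpCLM_le
  have hS0 : 0 ≤ ∑ k ∈ range (i + 1), (i.choose k : ℝ) * T k := by
    refine sum_nonneg fun k hk => ?_
    have hki : k ≤ i := Nat.lt_succ_iff.1 (mem_range.1 hk)
    have hT0 : 0 ≤ T k := (abs_nonneg _).trans (hT k (hki.trans hi4))
    positivity
  exact mul_le_mul hT2 (hL.trans (sum_le_sum hterm)) (norm_nonneg _) (by norm_num)

/-- **The four orders spelled out**: from `|u| ≤ T₀, |u′| ≤ T₁, |u″| ≤ T₂, |u‴| ≤ T₃, |u⁗| ≤ T₄` (at `θ`, `deriv`-tower form):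
`‖D¹γ‖ ≤ 2(T₀+T₁)`, `‖D²γ‖ ≤ 2(T₀+2T₁+T₂)`, `‖D³γ‖ ≤ 2(T₀+3T₁+3T₂+T₃)`, `‖D⁴γ‖ ≤ 2(T₀+4T₁+6T₂+4T₃+T₄)`. -/
theorem norm_iteratedFDeriv_fermiPointLp_le_four_orders {θ T₀ T₁ T₂ T₃ T₄ : ℝ}
    (h0 : |perturbedFermiRadius (fun p : Fin 2 → ℝ => -K.eval p) μ θ| ≤ T₀)
    (h1 : |deriv (perturbedFermiRadius (fun p : Fin 2 → ℝ => -K.eval p) μ) θ| ≤ T₁)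
    (h2 : |deriv (deriv (perturbedFermiRadius (fun p : Fin 2 → ℝ => -K.eval p) μ)) θ| ≤ T₂)
    (h3 : |deriv (deriv (deriv (perturbedFermiRadius (fun p : Fin 2 → ℝ => -K.eval p) μ))) θ| ≤ T₃)
    (h4 : |deriv (deriv (deriv (deriv (perturbedFermiRadius (fun p : Fin 2 → ℝ => -K.eval p) μ)))) θ| ≤ T₄) :
    ‖iteratedFDeriv ℝ 1 (fun θ : ℝ => (WithLp.toLp 2 (klFermiPoint μ K θ) : Momentum)) θ‖ ≤ 2 * (T₀ + T₁) ∧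
    ‖iteratedFDeriv ℝ 2 (fun θ : ℝ => (WithLp.toLp 2 (klFermiPoint μ K θ) : Momentum)) θ‖ ≤ 2 * (T₀ + 2 * T₁ + T₂) ∧
    ‖iteratedFDeriv ℝ 3 (fun θ : ℝ => (WithLp.toLp 2 (klFermiPoint μ K θ) : Momentum)) θ‖ ≤ 2 * (T₀ + 3 * T₁ + 3 * T₂ + T₃) ∧
    ‖iteratedFDeriv ℝ 4 (fun θ : ℝ => (WithLp.toLp 2 (klFermiPoint μ K θ) : Momentum)) θ‖ ≤
      2 * (T₀ + 4 * T₁ + 6 * T₂ + 4 * T₃ + T₄) := by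
  set u := perturbedFermiRadius (fun p : Fin 2 → ℝ => -K.eval p) μ with hudef
  have e1 : iteratedDeriv 1 u θ = deriv u θ := by rw [iteratedDeriv_one]
  have e2 : iteratedDeriv 2 u θ = deriv (deriv u) θ := by
    change iteratedDeriv (0 + 1 + 1) u θ = _
    rw [iteratedDeriv_succ, iteratedDeriv_succ, iteratedDeriv_zero]
  have e3 : iteratedDeriv 3 u θ = deriv (deriv (deriv u)) θ := by
    change iteratedDeriv (0 + 1 + 1 + 1) u θ = _
    rw [iteratedDeriv_succ, iteratedDeriv_succ, iteratedDeriv_succ, iteratedDeriv_zero]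
  have e4 : iteratedDeriv 4 u θ = deriv (deriv (deriv (deriv u))) θ := by
    change iteratedDeriv (0 + 1 + 1 + 1 + 1) u θ = _
    rw [iteratedDeriv_succ, iteratedDeriv_succ, iteratedDeriv_succ, iteratedDeriv_succ, iteratedDeriv_zero]
  set T : ℕ → ℝ := fun k => if k = 0 then T₀ else if k = 1 then T₁ else if k = 2 then T₂ else if k = 3 then T₃ else T₄ with hTdef
  have hT : ∀ k ≤ 4, |iteratedDeriv k u θ| ≤ T k := by
    intro k hk4
    interval_cases k
    · simpa [hTdef] using h0
    · rw [e1]; simpa [hTdef] using h1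
    · rw [e2]; simpa [hTdef] using h2
    · rw [e3]; simpa [hTdef] using h3
    · rw [e4]; simpa [hTdef] using h4
  have H := fun i (hi : i ≤ 4) => norm_iteratedFDeriv_fermiPointLp_le_perOrder B hA hADt hlo hhi (θ := θ) hT hi
  refine ⟨(H 1 (by norm_num)).trans (le_of_eq ?_), (H 2 (by norm_num)).trans (le_of_eq ?_),
    (H 3 (by norm_num)).trans (le_of_eq ?_), (H 4 le_rfl).trans (le_of_eq ?_)⟩ <;>
    simp [hTdef, sum_range_succ, Nat.choose]

end Curve

/-! ## §3 The regime: the radius tower and the curve sizes with `A₃, A₄` symbolic -/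

/-- **The radius tower of an admissible frame, explicit and order by order.**  For `0 < c ≤ klCurveC3 R`, `0 < U ≤ klCurveU0 R`,
`klBetaMin ≤ β ≤ e^{c/U²}`, `μ ∈ klWindowC`, `FrameOK R U (nScales β) μ K`, and ANY order-3/4 sizes `A₃ ≥ ‖D³ frameShift K‖`,
`A₄ ≥ ‖D⁴ frameShift K‖`: `|u_K| ≤ π√2`, `|u_K′| ≤ R1`, `|u_K″| ≤ R2` (ABSOLUTE), `|u_K‴| ≤ T3(A₃)`, `|u_K⁗| ≤ T4(A₃, A₄)` (AFFINE).
[cite: BenfattoGiulianiMastropietro2006, §2.4 Lemma 2.1 (2.40)] -/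
theorem frameRadius_tower_explicit {R : RenConsts} (hR : ∀ j, 0 ≤ R.Gfr j) {c : ℝ} (hc : 0 < c) (hcle : c ≤ klCurveC3 R)
    {U : ℝ} (hU : 0 < U) (hUle : U ≤ klCurveU0 R) {β : ℝ} (hβmin : klBetaMin ≤ β) (hβc : β ≤ Real.exp (c / U ^ 2))
    {μ : ℝ} (hμ : μ ∈ klWindowC) {K : TrigPolyC4v} (hK : FrameOK R U (nScales β) μ K)
    {A₃ A₄ : ℝ} (hA₃ : ∀ p : Momentum, ‖iteratedFDeriv ℝ 3 (frameShift K) p‖ ≤ A₃)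
    (hA₄ : ∀ p : Momentum, ‖iteratedFDeriv ℝ 4 (frameShift K) p‖ ≤ A₄) (θ : ℝ) :
    |perturbedFermiRadius (fun p : Fin 2 → ℝ => -K.eval p) μ θ| ≤ π * Real.sqrt 2 ∧
    |deriv (perturbedFermiRadius (fun p : Fin 2 → ℝ => -K.eval p) μ) θ| ≤ klCurveR1 ∧
    |deriv (deriv (perturbedFermiRadius (fun p : Fin 2 → ℝ => -K.eval p) μ)) θ| ≤ klCurveR2 ∧
    |deriv (deriv (deriv (perturbedFermiRadius (fun p : Fin 2 → ℝ => -K.eval p) μ))) θ| ≤ klCurveT3 A₃ ∧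
    |deriv (deriv (deriv (deriv (perturbedFermiRadius (fun p : Fin 2 → ℝ => -K.eval p) μ)))) θ| ≤ klCurveT4 A₃ A₄ := by
  have ha : (-4 : ℝ) < -1.1 := by norm_num
  have hab : (-1.1 : ℝ) ≤ -0.1 := by norm_num
  have hb : (-0.1 : ℝ) < 0 := by norm_num
  set B := bandBounds ha hab hb with hBdef
  obtain ⟨hAf, hA20, hADt, hhalf, ⟨hlo, hhi⟩, -, -⟩ := frame_sizes_of_frameOK_explicit hR hc hcle hU hUle hβmin hβc hμ hK
  set A := 2 * R.Gfr 0 * |U| + 2 * R.Gfr 1 * U ^ 2 + R.Gfr 2 * (c / Real.log 4) with hAdef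
  set d := klCurveD with hd
  have hdpos : 0 < d := klCurveD_pos
  set s := π * Real.sqrt 2 with hs
  have hs0 : 0 < s := by positivity
  have hr₁0 : 0 ≤ klCurveR1 := klCurveR1_nonneg
  have hr₂0 : 0 ≤ klCurveR2 := klCurveR2_nonneg
  have hA₃0 : 0 ≤ A₃ := (norm_nonneg _).trans (hA₃ 0)
  have hA₄0 : 0 ≤ A₄ := (norm_nonneg _).trans (hA₄ 0)
  have hr₃0 : 0 ≤ klCurveT3 A₃ := klCurveT3_nonneg hA₃0
  have hden : d ≤ B.Dtmin - 2 * A := hhalf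
  -- order 0
  have hR₀ : |perturbedFermiRadius (fun p : Fin 2 → ℝ => -K.eval p) μ θ| ≤ s := by
    rw [abs_of_pos (frameRadius_pos B hAf hlo hhi θ)]; exact frameRadius_le B hAf hlo hhi θ
  -- order 1
  have hR₁ : |deriv (perturbedFermiRadius (fun p : Fin 2 → ℝ => -K.eval p) μ) θ| ≤ klCurveR1 := by
    refine (abs_deriv_frameRadius_le_uniform B hAf hADt hlo hhi θ).trans ?_
    unfold klCurveR1; rw [← hd]
    exact div_relax (mul_le_mul_of_nonneg_right (by linarith only [hA20]) hs0.le) (by positivity) hdpos hden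
  -- order 2
  have hR₂ : |deriv (deriv (perturbedFermiRadius (fun p : Fin 2 → ℝ => -K.eval p) μ)) θ| ≤ klCurveR2 := by
    refine (abs_deriv_two_frameRadius_le B hAf hADt hlo hhi hR₁).trans ?_
    unfold klCurveR2; rw [← hd]
    have hK : 0 ≤ (klCurveR1 + s) ^ 2 := sq_nonneg _
    have hL : 0 ≤ 2 * klCurveR1 + s := by positivity
    exact div_relax (add_le_add (mul_le_mul_of_nonneg_right (by linarith only [hA20]) hK)
      (mul_le_mul_of_nonneg_right (by linarith only [hA20]) hL)) (by positivity) hdpos hden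
  -- order 3
  have hR₃ : |deriv (deriv (deriv (perturbedFermiRadius (fun p : Fin 2 → ℝ => -K.eval p) μ))) θ| ≤ klCurveT3 A₃ := by
    refine (abs_deriv_three_frameRadius_le B hAf hADt hlo hhi hA₃ hR₁ hR₂).trans ?_
    have hnum := num_three_le (G := A₃) (P := 1) hA20 (by rw [mul_one]) le_rfl hr₁0 hr₂0 hs0.le
    rw [mul_one] at hnum
    refine (div_relax hnum (by positivity) hdpos hden).trans (le_of_eq ?_)
    unfold klCurveT3; rw [← hd]
  -- order 4
  have hR₄ : |deriv (deriv (deriv (deriv (perturbedFermiRadius (fun p : Fin 2 → ℝ => -K.eval p) μ)))) θ| ≤ klCurveT4 A₃ A₄ := by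
    refine (abs_deriv_four_frameRadius_le B hAf hADt hlo hhi hA₃ hA₄ hR₁ hR₂ hR₃).trans ?_
    have hnum := num_four_le (G₃ := A₃) (G₄ := A₄) (P := 1) (Q := 1) (r₃ := klCurveT3 A₃) hA20 (by rw [mul_one]) (by rw [mul_one])
      hA₃0 le_rfl le_rfl hr₁0 hr₂0 hr₃0 hs0.le
    simp only [mul_one] at hnum
    refine (div_relax hnum (by positivity) hdpos hden).trans (le_of_eq ?_)
    unfold klCurveT4; rw [← hd]
  exact ⟨hR₀, hR₁, hR₂, hR₃, hR₄⟩

/-- **The curve sizes of an admissible frame, explicit and order by order**: same hypotheses;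
`‖D¹γ_K‖ ≤ klCurveD1`, `‖D²γ_K‖ ≤ klCurveD2`, `‖D³γ_K‖ ≤ klCurveD3 A₃`, `‖D⁴γ_K‖ ≤ klCurveD4 A₃ A₄` at every angle, and `γ_K` is `C⁴`. -/
theorem fermiPointLp_sizes_explicit {R : RenConsts} (hR : ∀ j, 0 ≤ R.Gfr j) {c : ℝ} (hc : 0 < c) (hcle : c ≤ klCurveC3 R)
    {U : ℝ} (hU : 0 < U) (hUle : U ≤ klCurveU0 R) {β : ℝ} (hβmin : klBetaMin ≤ β) (hβc : β ≤ Real.exp (c / U ^ 2))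
    {μ : ℝ} (hμ : μ ∈ klWindowC) {K : TrigPolyC4v} (hK : FrameOK R U (nScales β) μ K)
    {A₃ A₄ : ℝ} (hA₃ : ∀ p : Momentum, ‖iteratedFDeriv ℝ 3 (frameShift K) p‖ ≤ A₃)
    (hA₄ : ∀ p : Momentum, ‖iteratedFDeriv ℝ 4 (frameShift K) p‖ ≤ A₄) (θ : ℝ) :
    ContDiff ℝ 4 (fun θ : ℝ => (WithLp.toLp 2 (klFermiPoint μ K θ) : Momentum)) ∧
    ‖iteratedFDeriv ℝ 1 (fun θ : ℝ => (WithLp.toLp 2 (klFermiPoint μ K θ) : Momentum)) θ‖ ≤ klCurveD1 ∧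
    ‖iteratedFDeriv ℝ 2 (fun θ : ℝ => (WithLp.toLp 2 (klFermiPoint μ K θ) : Momentum)) θ‖ ≤ klCurveD2 ∧
    ‖iteratedFDeriv ℝ 3 (fun θ : ℝ => (WithLp.toLp 2 (klFermiPoint μ K θ) : Momentum)) θ‖ ≤ klCurveD3 A₃ ∧
    ‖iteratedFDeriv ℝ 4 (fun θ : ℝ => (WithLp.toLp 2 (klFermiPoint μ K θ) : Momentum)) θ‖ ≤ klCurveD4 A₃ A₄ := by
  have ha : (-4 : ℝ) < -1.1 := by norm_num
  have hab : (-1.1 : ℝ) ≤ -0.1 := by norm_num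
  have hb : (-0.1 : ℝ) < 0 := by norm_num
  set B := bandBounds ha hab hb with hBdef
  obtain ⟨hAf, hA20, hADt, hhalf, ⟨hlo, hhi⟩, -, -⟩ := frame_sizes_of_frameOK_explicit hR hc hcle hU hUle hβmin hβc hμ hK
  obtain ⟨h0, h1, h2, h3, h4⟩ := frameRadius_tower_explicit hR hc hcle hU hUle hβmin hβc hμ hK hA₃ hA₄ θ
  obtain ⟨g1, g2, g3, g4⟩ := norm_iteratedFDeriv_fermiPointLp_le_four_orders B hAf hADt hlo hhi h0 h1 h2 h3 h4
  refine ⟨contDiff_four_fermiPointLp B hAf hADt hlo hhi, g1.trans (le_of_eq ?_), g2.trans (le_of_eq ?_), g3.trans (le_of_eq ?_),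
    g4.trans (le_of_eq ?_)⟩
  · unfold klCurveD1; ring
  · unfold klCurveD2; ring
  · unfold klCurveD3; ring
  · unfold klCurveD4; ring

/-! ## §4 Structured sizes of a smooth symbol read along the curve -/

/-- **Structured angular sizes of `F ∘ γ_K`** (the analytic input of (E3a-MS)): in the regime, for an admissible frame with order-3/4
sizes `A₃, A₄` and any `C⁴` symbol `F : Momentum → ℝ` with `‖DᵏF(γ_K θ)‖ ≤ m k` (`1 ≤ k ≤ 4`; e.g. the scale-`n` increment interpolant with
its coefficient moments):
`|∂¹(F∘γ_K)| ≤ m1·D1`, `|∂²| ≤ m2·D1² + m1·D2`, `|∂³| ≤ m3·D1³ + 3m2·D1·D2 + m1·D3(A₃)`,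
`|∂⁴| ≤ m4·D1⁴ + 6m3·D1²·D2 + 3m2·D2² + 4m2·D1·D3(A₃) + m1·D4(A₃,A₄)` — the top orders are AFFINE in `A₃, A₄` (`klCurveD3/D4_affine`). -/
theorem abs_iteratedDeriv_comp_fermiPointLp_le_struct {R : RenConsts} (hR : ∀ j, 0 ≤ R.Gfr j) {c : ℝ} (hc : 0 < c)
    (hcle : c ≤ klCurveC3 R) {U : ℝ} (hU : 0 < U) (hUle : U ≤ klCurveU0 R) {β : ℝ} (hβmin : klBetaMin ≤ β)
    (hβc : β ≤ Real.exp (c / U ^ 2)) {μ : ℝ} (hμ : μ ∈ klWindowC) {K : TrigPolyC4v} (hK : FrameOK R U (nScales β) μ K)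
    {A₃ A₄ : ℝ} (hA₃ : ∀ p : Momentum, ‖iteratedFDeriv ℝ 3 (frameShift K) p‖ ≤ A₃)
    (hA₄ : ∀ p : Momentum, ‖iteratedFDeriv ℝ 4 (frameShift K) p‖ ≤ A₄)
    {F : Momentum → ℝ} (hF : ContDiff ℝ 4 F) {m : ℕ → ℝ} (θ : ℝ)
    (hm : ∀ k, 1 ≤ k → k ≤ 4 → ‖iteratedFDeriv ℝ k F (WithLp.toLp 2 (klFermiPoint μ K θ))‖ ≤ m k) :
    |iteratedDeriv 1 (F ∘ fun θ : ℝ => (WithLp.toLp 2 (klFermiPoint μ K θ) : Momentum)) θ| ≤ m 1 * klCurveD1 ∧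
    |iteratedDeriv 2 (F ∘ fun θ : ℝ => (WithLp.toLp 2 (klFermiPoint μ K θ) : Momentum)) θ| ≤
      m 2 * klCurveD1 ^ 2 + m 1 * klCurveD2 ∧
    |iteratedDeriv 3 (F ∘ fun θ : ℝ => (WithLp.toLp 2 (klFermiPoint μ K θ) : Momentum)) θ| ≤
      m 3 * klCurveD1 ^ 3 + 3 * m 2 * klCurveD1 * klCurveD2 + m 1 * klCurveD3 A₃ ∧
    |iteratedDeriv 4 (F ∘ fun θ : ℝ => (WithLp.toLp 2 (klFermiPoint μ K θ) : Momentum)) θ| ≤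
      m 4 * klCurveD1 ^ 4 + 6 * m 3 * klCurveD1 ^ 2 * klCurveD2 + 3 * m 2 * klCurveD2 ^ 2 + 4 * m 2 * klCurveD1 * klCurveD3 A₃ +
        m 1 * klCurveD4 A₃ A₄ := by
  obtain ⟨hγ, g1, g2, g3, g4⟩ := fermiPointLp_sizes_explicit hR hc hcle hU hUle hβmin hβc hμ hK hA₃ hA₄ θ
  set D : ℕ → ℝ := fun i => if i = 1 then klCurveD1 else if i = 2 then klCurveD2 else if i = 3 then klCurveD3 A₃ else klCurveD4 A₃ A₄
    with hDdef
  have hD : ∀ i, 1 ≤ i → i ≤ 4 → ‖iteratedDeriv i (fun θ : ℝ => (WithLp.toLp 2 (klFermiPoint μ K θ) : Momentum)) θ‖ ≤ D i := by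
    intro i hi1 hi4
    rw [← norm_iteratedFDeriv_eq_norm_iteratedDeriv]
    interval_cases i
    · simpa [hDdef] using g1
    · simpa [hDdef] using g2
    · simpa [hDdef] using g3
    · simpa [hDdef] using g4
  obtain ⟨b1, b2, b3, b4⟩ := abs_iteratedDeriv_comp_le_bell hF hγ hm hD
  refine ⟨by simpa [hDdef] using b1, by simpa [hDdef] using b2, by simpa [hDdef] using b3, by simpa [hDdef] using b4⟩

end Summit.HubbardSuperconductivity.HubbardSuperconductivity.Theorems.PerturbedFermiCurve

end
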